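import Mathlib
import Summits.Ventures.PercRepro2.Defs
import Summits.Ventures.PercRepro2.Harris
import Summits.Ventures.PercRepro2.Graph
import Summits.Ventures.PercRepro2.Events
import Summits.Ventures.PercRepro2.PsiPinInduction
import Summits.Ventures.PercRepro2.PsiUniSure
import Summits.Ventures.PercRepro2.PsiUniExplored

/-!
# The pin induction for (R2-1) along the `o`-exploration (PercRepro2, p2)

The four-vertex inequality **(R2-1)** of the (PM⁺) line — the hypothesis `hR` of
`psi_bern_t_of_r21_psi0` — reads `0 ≤ R(p)` with the slack

  `R(p) = P(𝟙ah) + P(𝟙ℓa) + P(𝟙)·P(ah) − P(𝟙a)·P(h) − P(𝟙h)·P(a) − P(𝟙ℓ)·P(a)`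

(`𝟙 = {s ↮ y}`, `a = {u ∈ C_s}`, `h = {o ∈ C_s}`, `ℓ = {o ↔ y}`).  Along one edge `f` every mass is
affine in `w = p f` (`prob_eq_pin`), so `R` is a QUADRATIC in `w` with Bernstein form
`R = (1 − w)²·R⁰ + w(1 − w)·T + w²·R¹` (`r21_slack_eq_bernstein`), where `R⁰, R¹` are the slacks of
the two pinned instances and `T` is twice the mixed coefficient.  Hence (`r21_step_algebra`) the
slack is at least `min(R⁰, R¹)` as soon as `2·min(R⁰, R¹) ≤ T` — the one-edge property (UNI-R_f).

The induction runs along the `o`-EXPLORATION (the component `Λ` of `o` in the pinned-open graph):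
when every edge at `Λ` is pinned, the cluster of `o` is deterministic with a closed boundary and the
slack is IDENTICALLY ZERO (`r21_slack_eq_zero_of_explored_o`: the three cases `s ∈ Λ`, `y ∈ Λ`,
neither), so the frame `r21_slack_nonneg_of_uni_o` says: **(R2-1) holds for every admissible weight
vector as soon as every admissible vector with an unpinned edge at its explored `o`-component has
SOME such edge `f` with `2·min(R(p[f↦0]), R(p[f↦1])) ≤ T_f(p)`** — the statement (UNI-R_o) of
P2-G19-YCLUSTER.md §3c (census: 0 failures on the edges at the explored `o`-cluster; the UNIVERSAL
(UNI-R) for every edge is false, 1 / 35,846 at an edge at `y`).  This is the (R2-1) analogue of the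
frames `psi_slack_nonneg_of_uni` / `psi_slack_nonneg_of_bern_t` of the (Ψ)-slack.

* `r21_bernstein_algebra` — the quadratic identity in eighteen variables;
* `r21_step_algebra` — the one-edge step;
* `r21_slack_eq_bernstein` — the Bernstein form of the slack along an edge;
* `r21_slack_nonneg_of_step` — the pin induction (one good edge per instance);
* `r21_slack_eq_zero_of_explored_o` — the base: the slack vanishes when the `o`-cluster is explored;
* `r21_slack_nonneg_of_uni_o` — **the frame (R2-1) ⟸ (UNI-R_o)**.
-/

namespace Summit.Ventures.PercRepro2

section R21Pin

variable {V : Type*} {E : Type*} [Fintype E] [DecidableEq E]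
  {R : Type*} [CommRing R] [LinearOrder R] [IsStrictOrderedRing R]

omit [LinearOrder R] [IsStrictOrderedRing R] in
/-- The quadratic identity behind the one-edge Bernstein form of the (R2-1) slack: with
`A_i = (1 − w)·a_i + w·b_i`, `A₁ + A₂ + A₃A₄ − A₅A₆ − A₇A₈ − A₉A₈` equals
`(1 − w)²·(slack at a) + w(1 − w)·(mixed term) + w²·(slack at b)`. -/
lemma r21_bernstein_algebra (w a1 a2 a3 a4 a5 a6 a7 a8 a9 b1 b2 b3 b4 b5 b6 b7 b8 b9 : R) :
    ((1 - w) * a1 + w * b1) + ((1 - w) * a2 + w * b2) +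
        ((1 - w) * a3 + w * b3) * ((1 - w) * a4 + w * b4) -
      (((1 - w) * a5 + w * b5) * ((1 - w) * a6 + w * b6) +
        ((1 - w) * a7 + w * b7) * ((1 - w) * a8 + w * b8) +
        ((1 - w) * a9 + w * b9) * ((1 - w) * a8 + w * b8)) =
      (1 - w) ^ 2 * (a1 + a2 + a3 * a4 - (a5 * a6 + a7 * a8 + a9 * a8)) +
        w * (1 - w) * (a1 + b1 + a2 + b2 + a3 * b4 + b3 * a4 -
          (a5 * b6 + b5 * a6 + a7 * b8 + b7 * a8 + a9 * b8 + b9 * a8)) +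
        w ^ 2 * (b1 + b2 + b3 * b4 - (b5 * b6 + b7 * b8 + b9 * b8)) := by
  ring

/-- **The one-edge step.** If `0 ≤ w ≤ 1`, the two endpoint slacks are nonnegative and the mixed
term `T` satisfies `2·min(R⁰, R¹) ≤ T`, then `(1 − w)²R⁰ + w(1 − w)T + w²R¹ ≥ 0`. -/
lemma r21_step_algebra {w R0 R1 T : R} (hw : 0 ≤ w) (hw1 : w ≤ 1) (h0 : 0 ≤ R0) (h1 : 0 ≤ R1)
    (hT : 2 * min R0 R1 ≤ T) :
    0 ≤ (1 - w) ^ 2 * R0 + w * (1 - w) * T + w ^ 2 * R1 := by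
  have hm0 : min R0 R1 ≤ R0 := min_le_left _ _
  have hm1 : min R0 R1 ≤ R1 := min_le_right _ _
  have hmin : 0 ≤ min R0 R1 := le_min h0 h1
  have hw' : 0 ≤ 1 - w := by linarith
  have e1 : (1 - w) ^ 2 * R0 ≥ (1 - w) ^ 2 * min R0 R1 :=
    mul_le_mul_of_nonneg_left hm0 (by positivity)
  have e2 : w ^ 2 * R1 ≥ w ^ 2 * min R0 R1 := mul_le_mul_of_nonneg_left hm1 (by positivity)
  have e3 : w * (1 - w) * T ≥ w * (1 - w) * (2 * min R0 R1) :=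
    mul_le_mul_of_nonneg_left hT (mul_nonneg hw hw')
  have : (1 - w) ^ 2 * min R0 R1 + w * (1 - w) * (2 * min R0 R1) + w ^ 2 * min R0 R1 =
      min R0 R1 := by ring
  nlinarith [e1, e2, e3, this, hmin]

omit [LinearOrder R] [IsStrictOrderedRing R] in
/-- **The Bernstein form of the (R2-1) slack along an edge `f`**: with `w = p f`,
`R(p) = (1 − w)²·R(p[f↦0]) + w(1 − w)·T_f + w²·R(p[f↦1])`, `T_f` the symmetric mixed term of the nine
masses at the two pins. -/
lemma r21_slack_eq_bernstein (p : E → R) (ends : E → Sym2 V) (s y o u : V) (f : E) :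
    (prob p (connEvent ends s u ∩ clusterInEvent ends s {W : Set V | o ∈ W} ∩ (connEvent ends s y)ᶜ) + prob p (connEvent ends s u ∩ connEvent ends y o ∩ (connEvent ends s y)ᶜ) + prob p ((connEvent ends s y)ᶜ) * prob p (connEvent ends s u ∩ clusterInEvent ends s {W : Set V | o ∈ W}) - (prob p (connEvent ends s u ∩ (connEvent ends s y)ᶜ) * prob p (clusterInEvent ends s {W : Set V | o ∈ W}) + prob p (clusterInEvent ends s {W : Set V | o ∈ W} ∩ (connEvent ends s y)ᶜ) * prob p (connEvent ends s u) + prob p (connEvent ends y o ∩ (connEvent ends s y)ᶜ) * prob p (connEvent ends s u))) =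
      (1 - p f) ^ 2 * (prob (Function.update p f 0) (connEvent ends s u ∩ clusterInEvent ends s {W : Set V | o ∈ W} ∩ (connEvent ends s y)ᶜ) + prob (Function.update p f 0) (connEvent ends s u ∩ connEvent ends y o ∩ (connEvent ends s y)ᶜ) + prob (Function.update p f 0) ((connEvent ends s y)ᶜ) * prob (Function.update p f 0) (connEvent ends s u ∩ clusterInEvent ends s {W : Set V | o ∈ W}) - (prob (Function.update p f 0) (connEvent ends s u ∩ (connEvent ends s y)ᶜ) * prob (Function.update p f 0) (clusterInEvent ends s {W : Set V | o ∈ W}) + prob (Function.update p f 0) (clusterInEvent ends s {W : Set V | o ∈ W} ∩ (connEvent ends s y)ᶜ) * prob (Function.update p f 0) (connEvent ends s u) + prob (Function.update p f 0) (connEvent ends y o ∩ (connEvent ends s y)ᶜ) * prob (Function.update p f 0) (connEvent ends s u))) +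
        p f * (1 - p f) * (prob (Function.update p f 0) (connEvent ends s u ∩ clusterInEvent ends s {W : Set V | o ∈ W} ∩ (connEvent ends s y)ᶜ) + prob (Function.update p f 1) (connEvent ends s u ∩ clusterInEvent ends s {W : Set V | o ∈ W} ∩ (connEvent ends s y)ᶜ) + prob (Function.update p f 0) (connEvent ends s u ∩ connEvent ends y o ∩ (connEvent ends s y)ᶜ) + prob (Function.update p f 1) (connEvent ends s u ∩ connEvent ends y o ∩ (connEvent ends s y)ᶜ) + prob (Function.update p f 0) ((connEvent ends s y)ᶜ) * prob (Function.update p f 1) (connEvent ends s u ∩ clusterInEvent ends s {W : Set V | o ∈ W}) + prob (Function.update p f 1) ((connEvent ends s y)ᶜ) * prob (Function.update p f 0) (connEvent ends s u ∩ clusterInEvent ends s {W : Set V | o ∈ W}) - (prob (Function.update p f 0) (connEvent ends s u ∩ (connEvent ends s y)ᶜ) * prob (Function.update p f 1) (clusterInEvent ends s {W : Set V | o ∈ W}) + prob (Function.update p f 1) (connEvent ends s u ∩ (connEvent ends s y)ᶜ) * prob (Function.update p f 0) (clusterInEvent ends s {W : Set V | o ∈ W}) + prob (Function.update p f 0) (clusterInEvent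 ends s {W : Set V | o ∈ W} ∩ (connEvent ends s y)ᶜ) * prob (Function.update p f 1) (connEvent ends s u) + prob (Function.update p f 1) (clusterInEvent ends s {W : Set V | o ∈ W} ∩ (connEvent ends s y)ᶜ) * prob (Function.update p f 0) (connEvent ends s u) + prob (Function.update p f 0) (connEvent ends y o ∩ (connEvent ends s y)ᶜ) * prob (Function.update p f 1) (connEvent ends s u) + prob (Function.update p f 1) (connEvent ends y o ∩ (connEvent ends s y)ᶜ) * prob (Function.update p f 0) (connEvent ends s u))) +
        p f ^ 2 * (prob (Function.update p f 1) (connEvent ends s u ∩ clusterInEvent ends s {W : Set V | o ∈ W} ∩ (connEvent ends s y)ᶜ) + prob (Function.update p f 1) (connEvent ends s u ∩ connEvent ends y o ∩ (connEvent ends s y)ᶜ) + prob (Function.update p f 1) ((connEvent ends s y)ᶜ) * prob (Function.update p f 1) (connEvent ends s u ∩ clusterInEvent ends s {W : Set V | o ∈ W}) - (prob (Function.update p f 1) (connEvent ends s u ∩ (connEvent ends s y)ᶜ) * prob (Function.update p f 1) (clusterInEvent ends s {W : Set V | o ∈ W}) + prob (Function.update p f 1) (clusterInEvent ends s {W : Set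 V | o ∈ W} ∩ (connEvent ends s y)ᶜ) * prob (Function.update p f 1) (connEvent ends s u) + prob (Function.update p f 1) (connEvent ends y o ∩ (connEvent ends s y)ᶜ) * prob (Function.update p f 1) (connEvent ends s u))) := by
  have e := r21_bernstein_algebra (p f)
    (prob (Function.update p f 0) (connEvent ends s u ∩ clusterInEvent ends s {W : Set V | o ∈ W} ∩ (connEvent ends s y)ᶜ))
    (prob (Function.update p f 0) (connEvent ends s u ∩ connEvent ends y o ∩ (connEvent ends s y)ᶜ))
    (prob (Function.update p f 0) ((connEvent ends s y)ᶜ))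
    (prob (Function.update p f 0) (connEvent ends s u ∩ clusterInEvent ends s {W : Set V | o ∈ W}))
    (prob (Function.update p f 0) (connEvent ends s u ∩ (connEvent ends s y)ᶜ))
    (prob (Function.update p f 0) (clusterInEvent ends s {W : Set V | o ∈ W}))
    (prob (Function.update p f 0) (clusterInEvent ends s {W : Set V | o ∈ W} ∩ (connEvent ends s y)ᶜ))
    (prob (Function.update p f 0) (connEvent ends s u))
    (prob (Function.update p f 0) (connEvent ends y o ∩ (connEvent ends s y)ᶜ))
    (prob (Function.update p f 1) (connEvent ends s u ∩ clusterInEvent ends s {W : Set V | o ∈ W} ∩ (connEvent ends s y)ᶜ))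
    (prob (Function.update p f 1) (connEvent ends s u ∩ connEvent ends y o ∩ (connEvent ends s y)ᶜ))
    (prob (Function.update p f 1) ((connEvent ends s y)ᶜ))
    (prob (Function.update p f 1) (connEvent ends s u ∩ clusterInEvent ends s {W : Set V | o ∈ W}))
    (prob (Function.update p f 1) (connEvent ends s u ∩ (connEvent ends s y)ᶜ))
    (prob (Function.update p f 1) (clusterInEvent ends s {W : Set V | o ∈ W}))
    (prob (Function.update p f 1) (clusterInEvent ends s {W : Set V | o ∈ W} ∩ (connEvent ends s y)ᶜ))
    (prob (Function.update p f 1) (connEvent ends s u))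
    (prob (Function.update p f 1) (connEvent ends y o ∩ (connEvent ends s y)ᶜ))
  rw [← e]
  rw [prob_eq_pin p (connEvent ends s u ∩ clusterInEvent ends s {W : Set V | o ∈ W} ∩ (connEvent ends s y)ᶜ) f]
  rw [prob_eq_pin p (connEvent ends s u ∩ connEvent ends y o ∩ (connEvent ends s y)ᶜ) f]
  rw [prob_eq_pin p ((connEvent ends s y)ᶜ) f]
  rw [prob_eq_pin p (connEvent ends s u ∩ clusterInEvent ends s {W : Set V | o ∈ W}) f]
  rw [prob_eq_pin p (connEvent ends s u ∩ (connEvent ends s y)ᶜ) f]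
  rw [prob_eq_pin p (clusterInEvent ends s {W : Set V | o ∈ W}) f]
  rw [prob_eq_pin p (clusterInEvent ends s {W : Set V | o ∈ W} ∩ (connEvent ends s y)ᶜ) f]
  rw [prob_eq_pin p (connEvent ends s u) f]
  rw [prob_eq_pin p (connEvent ends y o ∩ (connEvent ends s y)ᶜ) f]
  ring

/-- For a point mass the (R2-1) slack vanishes identically (the boolean identity
`ahq + aℓq + q·ah − aq·h − hq·a − ℓq·a = 0`). -/
lemma r21Pin_slack_eq_zero (p : E → R) (h01 : ∀ e, p e = 0 ∨ p e = 1)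
    (ends : E → Sym2 V) (s y o u : V) :
    (prob p (connEvent ends s u ∩ clusterInEvent ends s {W : Set V | o ∈ W} ∩ (connEvent ends s y)ᶜ) + prob p (connEvent ends s u ∩ connEvent ends y o ∩ (connEvent ends s y)ᶜ) + prob p ((connEvent ends s y)ᶜ) * prob p (connEvent ends s u ∩ clusterInEvent ends s {W : Set V | o ∈ W}) - (prob p (connEvent ends s u ∩ (connEvent ends s y)ᶜ) * prob p (clusterInEvent ends s {W : Set V | o ∈ W}) + prob p (clusterInEvent ends s {W : Set V | o ∈ W} ∩ (connEvent ends s y)ᶜ) * prob p (connEvent ends s u) + prob p (connEvent ends y o ∩ (connEvent ends s y)ᶜ) * prob p (connEvent ends s u))) = 0 := by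
  classical
  simp only [psiPin_prob_eq_indicator h01]
  simp only [Set.indicator_apply, Set.mem_inter_iff, Set.mem_compl_iff, Pi.one_apply]
  by_cases h1 : (fun e => decide (p e = 1) : Config E) ∈ connEvent ends s u <;>
  by_cases h2 : (fun e => decide (p e = 1) : Config E) ∈ clusterInEvent ends s {W : Set V | o ∈ W} <;>
  by_cases h3 : (fun e => decide (p e = 1) : Config E) ∈ connEvent ends y o <;>
  by_cases h4 : (fun e => decide (p e = 1) : Config E) ∈ connEvent ends s y <;>
  simp [h1, h2, h3, h4]

/-- **The pin induction for (R2-1).** If every admissible `p` with an unpinned edge has SOME unpinned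
edge `f` such that the slack at `p` is nonnegative whenever the slacks at the two pins `p[f↦0]`, `p[f↦1]`
are, then the slack is nonnegative for every admissible `p` (induction on the number of unpinned
edges; a fully pinned vector is a point mass and the slack is `0`). -/
theorem r21_slack_nonneg_of_step (ends : E → Sym2 V) (s y o u : V)
    (hstep : ∀ p : E → R, IsProbVec p → (∃ e, p e ≠ 0 ∧ p e ≠ 1) →
      ∃ f, p f ≠ 0 ∧ p f ≠ 1 ∧
        (0 ≤ (prob (Function.update p f 0) (connEvent ends s u ∩ clusterInEvent ends s {W : Set V | o ∈ W} ∩ (connEvent ends s y)ᶜ) + prob (Function.update p f 0) (connEvent ends s u ∩ connEvent ends y o ∩ (connEvent ends s y)ᶜ) + prob (Function.update p f 0) ((connEvent ends s y)ᶜ) * prob (Function.update p f 0) (connEvent ends s u ∩ clusterInEvent ends s {W : Set V | o ∈ W}) - (prob (Function.update p f 0) (connEvent ends s u ∩ (connEvent ends s y)ᶜ) * prob (Function.update p f 0) (clusterInEvent ends s {W : Set V | o ∈ W}) + prob (Function.update p f 0) (clusterInEvent ends s {W : Set V | o ∈ W} ∩ (connEvent ends s y)ᶜ) * prob (Function.update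 p f 0) (connEvent ends s u) + prob (Function.update p f 0) (connEvent ends y o ∩ (connEvent ends s y)ᶜ) * prob (Function.update p f 0) (connEvent ends s u))) →
        0 ≤ (prob (Function.update p f 1) (connEvent ends s u ∩ clusterInEvent ends s {W : Set V | o ∈ W} ∩ (connEvent ends s y)ᶜ) + prob (Function.update p f 1) (connEvent ends s u ∩ connEvent ends y o ∩ (connEvent ends s y)ᶜ) + prob (Function.update p f 1) ((connEvent ends s y)ᶜ) * prob (Function.update p f 1) (connEvent ends s u ∩ clusterInEvent ends s {W : Set V | o ∈ W}) - (prob (Function.update p f 1) (connEvent ends s u ∩ (connEvent ends s y)ᶜ) * prob (Function.update p f 1) (clusterInEvent ends s {W : Set V | o ∈ W}) + prob (Function.update p f 1) (clusterInEvent ends s {W : Set V | o ∈ W} ∩ (connEvent ends s y)ᶜ) * prob (Function.update p f 1) (connEvent ends s u) + prob (Function.update p f 1) (connEvent ends y o ∩ (connEvent ends s y)ᶜ) * prob (Function.update p f 1) (connEvent ends s u))) →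
        0 ≤ (prob p (connEvent ends s u ∩ clusterInEvent ends s {W : Set V | o ∈ W} ∩ (connEvent ends s y)ᶜ) + prob p (connEvent ends s u ∩ connEvent ends y o ∩ (connEvent ends s y)ᶜ) + prob p ((connEvent ends s y)ᶜ) * prob p (connEvent ends s u ∩ clusterInEvent ends s {W : Set V | o ∈ W}) - (prob p (connEvent ends s u ∩ (connEvent ends s y)ᶜ) * prob p (clusterInEvent ends s {W : Set V | o ∈ W}) + prob p (clusterInEvent ends s {W : Set V | o ∈ W} ∩ (connEvent ends s y)ᶜ) * prob p (connEvent ends s u) + prob p (connEvent ends y o ∩ (connEvent ends s y)ᶜ) * prob p (connEvent ends s u))))) :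
    ∀ p : E → R, IsProbVec p → 0 ≤ (prob p (connEvent ends s u ∩ clusterInEvent ends s {W : Set V | o ∈ W} ∩ (connEvent ends s y)ᶜ) + prob p (connEvent ends s u ∩ connEvent ends y o ∩ (connEvent ends s y)ᶜ) + prob p ((connEvent ends s y)ᶜ) * prob p (connEvent ends s u ∩ clusterInEvent ends s {W : Set V | o ∈ W}) - (prob p (connEvent ends s u ∩ (connEvent ends s y)ᶜ) * prob p (clusterInEvent ends s {W : Set V | o ∈ W}) + prob p (clusterInEvent ends s {W : Set V | o ∈ W} ∩ (connEvent ends s y)ᶜ) * prob p (connEvent ends s u) + prob p (connEvent ends y o ∩ (connEvent ends s y)ᶜ) * prob p (connEvent ends s u))) := by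
  have key : ∀ n : ℕ, ∀ p : E → R, IsProbVec p →
      (Finset.univ.filter fun e => p e ≠ 0 ∧ p e ≠ 1).card = n → 0 ≤ (prob p (connEvent ends s u ∩ clusterInEvent ends s {W : Set V | o ∈ W} ∩ (connEvent ends s y)ᶜ) + prob p (connEvent ends s u ∩ connEvent ends y o ∩ (connEvent ends s y)ᶜ) + prob p ((connEvent ends s y)ᶜ) * prob p (connEvent ends s u ∩ clusterInEvent ends s {W : Set V | o ∈ W}) - (prob p (connEvent ends s u ∩ (connEvent ends s y)ᶜ) * prob p (clusterInEvent ends s {W : Set V | o ∈ W}) + prob p (clusterInEvent ends s {W : Set V | o ∈ W} ∩ (connEvent ends s y)ᶜ) * prob p (connEvent ends s u) + prob p (connEvent ends y o ∩ (connEvent ends s y)ᶜ) * prob p (connEvent ends s u))) := by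
    intro n
    induction n with
    | zero =>
      intro p hp hcard
      have h01 : ∀ e, p e = 0 ∨ p e = 1 := by
        intro e
        by_contra hne
        have hne' : p e ≠ 0 ∧ p e ≠ 1 := ⟨fun h => hne (Or.inl h), fun h => hne (Or.inr h)⟩
        have : e ∈ (Finset.univ.filter fun e => p e ≠ 0 ∧ p e ≠ 1) := by
          simp [hne']
        rw [Finset.card_eq_zero.1 hcard] at this
        exact absurd this (Finset.notMem_empty e)
      rw [r21Pin_slack_eq_zero p h01 ends s y o u]
    | succ n ih =>
      intro p hp hcard
      have hex : ∃ e, p e ≠ 0 ∧ p e ≠ 1 := by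
        have hpos : 0 < (Finset.univ.filter fun e => p e ≠ 0 ∧ p e ≠ 1).card := by
          rw [hcard]; exact Nat.succ_pos n
        obtain ⟨e, he⟩ := Finset.card_pos.1 hpos
        simp only [Finset.mem_filter, Finset.mem_univ, true_and] at he
        exact ⟨e, he⟩
      obtain ⟨f, hf0, hf1, hstepf⟩ := hstep p hp hex
      have hmem : f ∈ (Finset.univ.filter fun e => p e ≠ 0 ∧ p e ≠ 1) := by simp [hf0, hf1]
      have hcard' : ∀ c : R, c = 0 ∨ c = 1 →
          (Finset.univ.filter fun e => Function.update p f c e ≠ 0 ∧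
            Function.update p f c e ≠ 1).card = n := by
        intro c hc
        rw [psiPin_filter_unpinned_update p f c hc, Finset.card_erase_of_mem hmem, hcard]
        rfl
      have h0 := ih (Function.update p f 0) (hp.update f le_rfl zero_le_one) (hcard' 0 (Or.inl rfl))
      have h1 := ih (Function.update p f 1) (hp.update f zero_le_one le_rfl) (hcard' 1 (Or.inr rfl))
      exact hstepf h0 h1
  intro p hp
  exact key _ p hp rfl

omit [Fintype E] [DecidableEq E] [LinearOrder R] [IsStrictOrderedRing R] in
/-- `{C_x ∈ {W | v ∈ W}} = {x ↔ v}`. -/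
lemma clusterInEvent_mem_eq_connEvent_ycl (ends : E → Sym2 V) (x v : V) :
    clusterInEvent ends x {W : Set V | v ∈ W} = connEvent ends x v := by
  ext ω
  simp [clusterInEvent, cluster, connEvent]

/-- **The base of the `o`-exploration.** When every edge at the explored `o`-component (the component
of `o` along the edges with `p e = 1`) is pinned, the cluster of `o` is deterministic with a closed
boundary and the (R2-1) slack vanishes: if `s ∈ Λ` then `h` is sure and either `y ∈ Λ` (`𝟙` null) or
`y ∉ Λ` (`ℓ` null); if `s ∉ Λ` then `h` is null and either `y ∈ Λ` (`ℓ` sure, `𝟙` sure) or `y ∉ Λ`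
(`ℓ` null). -/
lemma r21_slack_eq_zero_of_explored_o (p : E → R) (hp : IsProbVec p) (ends : E → Sym2 V)
    (s y o u : V)
    (hpin : ∀ e, (∃ v ∈ ends e, Conn ends (fun e => decide (p e = 1)) o v) → p e = 0 ∨ p e = 1) :
    (prob p (connEvent ends s u ∩ clusterInEvent ends s {W : Set V | o ∈ W} ∩ (connEvent ends s y)ᶜ) + prob p (connEvent ends s u ∩ connEvent ends y o ∩ (connEvent ends s y)ᶜ) + prob p ((connEvent ends s y)ᶜ) * prob p (connEvent ends s u ∩ clusterInEvent ends s {W : Set V | o ∈ W}) - (prob p (connEvent ends s u ∩ (connEvent ends s y)ᶜ) * prob p (clusterInEvent ends s {W : Set V | o ∈ W}) + prob p (clusterInEvent ends s {W : Set V | o ∈ W} ∩ (connEvent ends s y)ᶜ) * prob p (connEvent ends s u) + prob p (connEvent ends y o ∩ (connEvent ends s y)ᶜ) * prob p (connEvent ends s u))) = 0 := by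
  classical
  have hsq : connEvent ends s u ∩ clusterInEvent ends s {W : Set V | o ∈ W} ∩ (connEvent ends s y)ᶜ =
      connEvent ends s u ∩ (connEvent ends s y)ᶜ ∩ clusterInEvent ends s {W : Set V | o ∈ W} :=
    Set.inter_right_comm _ _ _
  have hqh : clusterInEvent ends s {W : Set V | o ∈ W} ∩ (connEvent ends s y)ᶜ =
      (connEvent ends s y)ᶜ ∩ clusterInEvent ends s {W : Set V | o ∈ W} := Set.inter_comm _ _
  have hh_eq : clusterInEvent ends s {W : Set V | o ∈ W} = connEvent ends o s := by
    rw [clusterInEvent_mem_eq_connEvent_ycl, connEvent_comm]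
  have hl_eq : connEvent ends y o = connEvent ends o y := connEvent_comm _ _ _
  -- a left factor null makes the intersection null
  have null_left : ∀ A B : Set (Config E), prob p A = 0 → prob p (A ∩ B) = 0 := fun A B hA =>
    le_antisymm ((prob_mono hp Set.inter_subset_left).trans hA.le) (prob_nonneg hp _)
  by_cases hs : Conn ends (fun e => decide (p e = 1)) o s
  · have hh : prob p (clusterInEvent ends s {W : Set V | o ∈ W}) = 1 := by
      rw [hh_eq]; exact prob_connEvent_eq_one_of_explored p ends hs
    by_cases hy : Conn ends (fun e => decide (p e = 1)) o y
    · -- `s, y ∈ Λ`: `s ↔ y` is sure, `𝟙` is null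
      have hl : prob p (connEvent ends y o) = 1 := by
        rw [hl_eq]; exact prob_connEvent_eq_one_of_explored p ends hy
      have hsy : prob p (connEvent ends s y) = 1 := by
        refine le_antisymm (prob_le_one hp _) ?_
        have h1 : prob p (connEvent ends o s ∩ connEvent ends o y) = 1 := by
          rw [prob_inter_of_eq_one hp (by rw [hl_eq] at hl; exact hl)]
          rw [hh_eq] at hh; exact hh
        rw [← h1]
        refine prob_mono hp fun ω hω => ?_
        exact conn_trans (conn_symm hω.1) hω.2
      have hq : prob p (connEvent ends s y)ᶜ = 0 := by rw [prob_compl, hsy]; ring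
      rw [prob_inter_eq_zero_of_right hp hq, prob_inter_eq_zero_of_right hp hq, hq,
        prob_inter_eq_zero_of_right hp hq, prob_inter_eq_zero_of_right hp hq,
        prob_inter_eq_zero_of_right hp hq]
      ring
    · -- `s ∈ Λ`, `y ∉ Λ`: `h` is sure, `ℓ` is null
      have hl : prob p (connEvent ends y o) = 0 := by
        rw [hl_eq]; exact prob_connEvent_eq_zero_of_explored p ends hpin hy
      rw [hsq, prob_inter_of_eq_one hp hh, prob_inter_of_eq_one hp hh, hh, hqh,
        prob_inter_of_eq_one hp hh,
        null_left (connEvent ends s u ∩ connEvent ends y o) _ (prob_inter_eq_zero_of_right hp hl _),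
        null_left (connEvent ends y o) _ hl]
      ring
  · have hh : prob p (clusterInEvent ends s {W : Set V | o ∈ W}) = 0 := by
      rw [hh_eq]; exact prob_connEvent_eq_zero_of_explored p ends hpin hs
    by_cases hy : Conn ends (fun e => decide (p e = 1)) o y
    · -- `s ∉ Λ`, `y ∈ Λ`: `h` is null, `ℓ` is sure, `𝟙` is sure
      have hl : prob p (connEvent ends y o) = 1 := by
        rw [hl_eq]; exact prob_connEvent_eq_one_of_explored p ends hy
      have hsy : prob p (connEvent ends s y) = 0 := by
        refine le_antisymm ?_ (prob_nonneg hp _)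
        rw [← prob_inter_of_eq_one hp hl (connEvent ends s y)]
        calc prob p (connEvent ends s y ∩ connEvent ends y o)
            ≤ prob p (clusterInEvent ends s {W : Set V | o ∈ W}) := by
              rw [hh_eq]
              refine prob_mono hp fun ω hω => ?_
              exact conn_symm (conn_trans hω.1 hω.2)
          _ = 0 := hh
      have hq : prob p (connEvent ends s y)ᶜ = 1 := by rw [prob_compl, hsy]; ring
      rw [hsq, prob_inter_eq_zero_of_right hp hh, prob_inter_eq_zero_of_right hp hh, hh, hqh,
        prob_inter_eq_zero_of_right hp hh,
        prob_inter_of_eq_one hp hq (connEvent ends s u ∩ connEvent ends y o),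
        prob_inter_of_eq_one hp hl (connEvent ends s u), hq,
        prob_inter_of_eq_one hp hq (connEvent ends s u),
        prob_inter_of_eq_one hp hq (connEvent ends y o), hl]
      ring
    · -- `s ∉ Λ`, `y ∉ Λ`: `h` and `ℓ` are null
      have hl : prob p (connEvent ends y o) = 0 := by
        rw [hl_eq]; exact prob_connEvent_eq_zero_of_explored p ends hpin hy
      rw [hsq, prob_inter_eq_zero_of_right hp hh, prob_inter_eq_zero_of_right hp hh, hh, hqh,
        prob_inter_eq_zero_of_right hp hh,
        null_left (connEvent ends s u ∩ connEvent ends y o) _ (prob_inter_eq_zero_of_right hp hl _),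
        null_left (connEvent ends y o) _ hl]
      ring

/-- **The frame (R2-1) ⟸ (UNI-R_o).** If every admissible `p` with an unpinned edge at its explored
`o`-component has SOME such edge `f` whose symmetric mixed Bernstein term `T_f(p)` is at least twice
the smaller of the two pinned slacks, then `0 ≤ R(p)` for every admissible `p`: the induction is
`r21_slack_nonneg_of_step`, the step along `f` is `r21_slack_eq_bernstein` + `r21_step_algebra`, and
instances with no unpinned edge at the explored component are the base
`r21_slack_eq_zero_of_explored_o`. -/
theorem r21_slack_nonneg_of_uni_o (ends : E → Sym2 V) (s y o u : V)
    (huni : ∀ p : E → R, IsProbVec p →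
      (∃ e, (∃ v ∈ ends e, Conn ends (fun e => decide (p e = 1)) o v) ∧ p e ≠ 0 ∧ p e ≠ 1) →
      ∃ f, (∃ v ∈ ends f, Conn ends (fun e => decide (p e = 1)) o v) ∧ p f ≠ 0 ∧ p f ≠ 1 ∧
        2 * min (prob (Function.update p f 0) (connEvent ends s u ∩ clusterInEvent ends s {W : Set V | o ∈ W} ∩ (connEvent ends s y)ᶜ) + prob (Function.update p f 0) (connEvent ends s u ∩ connEvent ends y o ∩ (connEvent ends s y)ᶜ) + prob (Function.update p f 0) ((connEvent ends s y)ᶜ) * prob (Function.update p f 0) (connEvent ends s u ∩ clusterInEvent ends s {W : Set V | o ∈ W}) - (prob (Function.update p f 0) (connEvent ends s u ∩ (connEvent ends s y)ᶜ) * prob (Function.update p f 0) (clusterInEvent ends s {W : Set V | o ∈ W}) + prob (Function.update p f 0) (clusterInEvent ends s {W : Set V | o ∈ W} ∩ (connEvent ends s y)ᶜ) * prob (Function.update p f 0) (connEvent ends s u) + prob (Function.update p f 0) (connEvent ends y o ∩ (connEvent ends s y)ᶜ) * prob (Function.update p f 0) (connEvent ends s u))) (prob (Function.update p f 1) (connEvent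 ends s u ∩ clusterInEvent ends s {W : Set V | o ∈ W} ∩ (connEvent ends s y)ᶜ) + prob (Function.update p f 1) (connEvent ends s u ∩ connEvent ends y o ∩ (connEvent ends s y)ᶜ) + prob (Function.update p f 1) ((connEvent ends s y)ᶜ) * prob (Function.update p f 1) (connEvent ends s u ∩ clusterInEvent ends s {W : Set V | o ∈ W}) - (prob (Function.update p f 1) (connEvent ends s u ∩ (connEvent ends s y)ᶜ) * prob (Function.update p f 1) (clusterInEvent ends s {W : Set V | o ∈ W}) + prob (Function.update p f 1) (clusterInEvent ends s {W : Set V | o ∈ W} ∩ (connEvent ends s y)ᶜ) * prob (Function.update p f 1) (connEvent ends s u) + prob (Function.update p f 1) (connEvent ends y o ∩ (connEvent ends s y)ᶜ) * prob (Function.update p f 1) (connEvent ends s u))) ≤ (prob (Function.update p f 0) (connEvent ends s u ∩ clusterInEvent ends s {W : Set V | o ∈ W} ∩ (connEvent ends s y)ᶜ) + prob (Function.update p f 1) (connEvent ends s u ∩ clusterInEvent ends s {W : Set V | o ∈ W} ∩ (connEvent ends s y)ᶜ) + prob (Function.update p f 0) (connEvent ends s u ∩ connEvent ends y o ∩ (connEvent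 ends s y)ᶜ) + prob (Function.update p f 1) (connEvent ends s u ∩ connEvent ends y o ∩ (connEvent ends s y)ᶜ) + prob (Function.update p f 0) ((connEvent ends s y)ᶜ) * prob (Function.update p f 1) (connEvent ends s u ∩ clusterInEvent ends s {W : Set V | o ∈ W}) + prob (Function.update p f 1) ((connEvent ends s y)ᶜ) * prob (Function.update p f 0) (connEvent ends s u ∩ clusterInEvent ends s {W : Set V | o ∈ W}) - (prob (Function.update p f 0) (connEvent ends s u ∩ (connEvent ends s y)ᶜ) * prob (Function.update p f 1) (clusterInEvent ends s {W : Set V | o ∈ W}) + prob (Function.update p f 1) (connEvent ends s u ∩ (connEvent ends s y)ᶜ) * prob (Function.update p f 0) (clusterInEvent ends s {W : Set V | o ∈ W}) + prob (Function.update p f 0) (clusterInEvent ends s {W : Set V | o ∈ W} ∩ (connEvent ends s y)ᶜ) * prob (Function.update p f 1) (connEvent ends s u) + prob (Function.update p f 1) (clusterInEvent ends s {W : Set V | o ∈ W} ∩ (connEvent ends s y)ᶜ) * prob (Function.update p f 0) (connEvent ends s u) + prob (Function.update p f 0) (connEvent ends y o ∩ (connEvent ends s y)ᶜ) * prob (Function.update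 p f 1) (connEvent ends s u) + prob (Function.update p f 1) (connEvent ends y o ∩ (connEvent ends s y)ᶜ) * prob (Function.update p f 0) (connEvent ends s u)))) :
    ∀ p : E → R, IsProbVec p → 0 ≤ (prob p (connEvent ends s u ∩ clusterInEvent ends s {W : Set V | o ∈ W} ∩ (connEvent ends s y)ᶜ) + prob p (connEvent ends s u ∩ connEvent ends y o ∩ (connEvent ends s y)ᶜ) + prob p ((connEvent ends s y)ᶜ) * prob p (connEvent ends s u ∩ clusterInEvent ends s {W : Set V | o ∈ W}) - (prob p (connEvent ends s u ∩ (connEvent ends s y)ᶜ) * prob p (clusterInEvent ends s {W : Set V | o ∈ W}) + prob p (clusterInEvent ends s {W : Set V | o ∈ W} ∩ (connEvent ends s y)ᶜ) * prob p (connEvent ends s u) + prob p (connEvent ends y o ∩ (connEvent ends s y)ᶜ) * prob p (connEvent ends s u))) := by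
  refine r21_slack_nonneg_of_step ends s y o u fun p hp hex => ?_
  by_cases hT : ∃ e, (∃ v ∈ ends e, Conn ends (fun e => decide (p e = 1)) o v) ∧ p e ≠ 0 ∧ p e ≠ 1
  · obtain ⟨f, _, hf0, hf1, hTf⟩ := huni p hp hT
    refine ⟨f, hf0, hf1, fun h0 h1 => ?_⟩
    rw [r21_slack_eq_bernstein p ends s y o u f]
    exact r21_step_algebra (hp.nonneg f) (hp.le_one f) h0 h1 hTf
  · obtain ⟨e, he0, he1⟩ := hex
    have hpin : ∀ e, (∃ v ∈ ends e, Conn ends (fun e => decide (p e = 1)) o v) →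
        p e = 0 ∨ p e = 1 := by
      intro e hv
      by_contra hne
      exact hT ⟨e, hv, fun h => hne (Or.inl h), fun h => hne (Or.inr h)⟩
    exact ⟨e, he0, he1, fun _ _ => by
      rw [r21_slack_eq_zero_of_explored_o p hp ends s y o u hpin]⟩

end R21Pin

end Summit.Ventures.PercRepro2
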